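import Summits.ValiantsHypothesis.ValiantsHypothesis.Theorems.GrenetZeonDualUnipotentThreeHalvesLongMassValueSpaceMono
import Summits.ValiantsHypothesis.ValiantsHypothesis.Theorems.GrenetZeonDualUnipotentThreeHalvesLongMassValueSpaceFree
import Summits.ValiantsHypothesis.ValiantsHypothesis.Theorems.GrenetZeonDualUnipotentThreeHalvesLongMassRankOneGeneral

/-!
# `GrenetZeon.DualUnipotentThreeHalves` (stmt-ValiantsHypothesis-24318), line `slow_core`, stub (c) `SlowCore.LongMassSlowLawInv`:
# SUB-SPACES OF NILPOTENT RANK-ONE SPANS ARE (c)-CHEAP (`c = 3`)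

Monotone form of the intrinsic rank-one row (✓ `…LongMassRankOneSpan.relCert_of_valueSpace_spanned_by_rankOne`, same hand), through the
monotonicity of the price in the value space (✓ `relCert_of_valueSpace_le`, `…LongMassValueSpaceMono`):

★★★ `relCert_of_valueSpace_le_rankOneSpan` — let `u_e w_eᵀ` (`e` over the `n²` coordinates) be rank-`≤ 1` matrices whose span is a NILPOTENT
space (`(Σ_e x_e u_e w_eᵀ)^H = 0` for every `x`).  Then EVERY linear affine pencil `N` over the `n²` coordinates whose value space is CONTAINED in
that span — arbitrary linear dependencies among its entries, its own coefficient matrices of any rank, its own value space NOT necessarily spanned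
by rank-one elements — has `RelCert n b N (3·(⌊√n⌋·b))`.  Example: every linear pencil whose values are supported on a fixed acyclic pattern
(`u_e w_eᵀ` = matrix units of the pattern) — the acyclic-support row ✓ `TriangularRow.relCert_of_acyclicSupport` — is the special case of
coordinate matrix units; here the rank-one generators are arbitrary.

So the (c)-content (crit-7 V34 §2) lives on value spaces `W̄` contained in NO nilpotent space spanned by rank-one matrices.  Honest framing.  A
support row (`--supports stmt-ValiantsHypothesis-24318`), NOT progress on (c): (c) `SlowCore.LongMassSlowLawInv`, S3, the crux 24318, 8062 and
`VP ≠ VNP` remain OPEN / NOT proved.  No sorry, no definitions, no named facts.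
-/

-- single-conjunct layout: Sub = Summit, duplicated namespace component intended (the name is mandated)
set_option linter.dupNamespace false
set_option autoImplicit false

noncomputable section

namespace Summit.ValiantsHypothesis.ValiantsHypothesis.Theorems.GrenetZeon.LongMassHomogenise

open MvPolynomial Matrix
open scoped BigOperators
open Summit.ValiantsHypothesis.ValiantsHypothesis.Cruxes.TwoDimCoefficients.DimTwoCases (AffMat IsAffine)
open Summit.ValiantsHypothesis.ValiantsHypothesis.Theorems.GrenetZeon.SlowCore
open Summit.ValiantsHypothesis.ValiantsHypothesis.Theorems.GrenetZeon.ResolventFlag (linMat)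
open Summit.ValiantsHypothesis.ValiantsHypothesis.Theorems.GrenetZeon.LongMassRankOne (relCert_of_rankOne_linearPart)

variable {n b : ℕ}

/-- A polynomial matrix all of whose values have vanishing `H`-th power has vanishing `H`-th power. -/
theorem pow_eq_zero_of_forall_map_eval (N : AffMat n b) {H : ℕ} (h : ∀ y : Fin n × Fin n → ℂ, (N.map (eval y)) ^ H = 0) :
    N ^ H = 0 := by
  refine Matrix.ext fun i j => ?_
  apply MvPolynomial.funext
  intro y
  have := congr_fun (congr_fun (h y) i) j
  rw [← Matrix.map_pow, Matrix.map_apply, Matrix.zero_apply] at this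
  rw [this, Matrix.zero_apply, map_zero]

/-- ★★★ **SUB-SPACES OF NILPOTENT RANK-ONE SPANS ARE (c)-CHEAP.**  If the rank-`≤ 1` matrices `u_e w_eᵀ` span a nilpotent space and the value
space of the linear affine pencil `N` is contained in that span, then `RelCert n b N (3·(⌊√n⌋·b))`. -/
theorem relCert_of_valueSpace_le_rankOneSpan (N : AffMat n b) (hN : IsAffine N) (h0 : ∀ i j, coeff 0 (N i j) = 0)
    (u w : Fin n × Fin n → Fin b → ℂ) {H : ℕ}
    (hnil : ∀ x : Fin n × Fin n → ℂ, (∑ e, x e • vecMulVec (u e) (w e)) ^ H = 0)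
    (hle : ∀ v, ∃ c : Fin n × Fin n → ℂ, linMat N v = ∑ e, c e • vecMulVec (u e) (w e)) :
    RelCert n b N (3 * (Nat.sqrt n * b)) := by
  classical
  -- the coordinate pencil `N₁ = Σ_e x_e · u_e w_eᵀ`
  let M : Fin n × Fin n → Matrix (Fin b) (Fin b) ℂ := fun e => vecMulVec (u e) (w e)
  let N₁ : AffMat n b := Matrix.of fun i j => ∑ e, C (M e i j) * X e
  have hN₁ : ∀ i j, N₁ i j = ∑ e, C (M e i j) * X e := fun i j => rfl
  have haff : IsAffine N₁ := by
    intro i j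
    rw [hN₁ i j]
    refine (totalDegree_finsetSum _ _).trans (Finset.sup_le fun e _ => ?_)
    exact (totalDegree_mul _ _).trans (by rw [totalDegree_C, totalDegree_X, zero_add])
  have h0₁ : ∀ i j, coeff 0 (N₁ i j) = 0 := by
    intro i j
    rw [hN₁ i j, coeff_sum]
    simp [coeff_C_mul]
  have hcoef : ∀ e i j, coeff (Finsupp.single e 1) (N₁ i j) = M e i j := by
    intro e i j
    rw [hN₁ i j, coeff_sum]
    simp only [coeff_C_mul, coeff_X, mul_ite, mul_one, mul_zero]
    rw [Finset.sum_eq_single e]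
    · simp
    · intro e' _ hne
      rw [if_neg]
      intro h
      exact hne ((Finsupp.single_left_inj one_ne_zero).mp h)
    · intro h; exact absurd (Finset.mem_univ e) h
  have hval : ∀ v, linMat N₁ v = ∑ e, v e • M e := by
    intro v
    ext i j
    rw [linMat, Matrix.of_apply, linEntry, Matrix.sum_apply]
    refine Finset.sum_congr rfl fun e _ => ?_
    rw [hcoef, Matrix.smul_apply, smul_eq_mul]
  -- `N₁` is nilpotent: its values are the members of the span
  have hnil₁ : N₁ ^ H = 0 := by
    refine pow_eq_zero_of_forall_map_eval N₁ fun y => ?_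
    rw [map_eval_eq_linMat_of_linear N₁ haff h0₁ y, hval y]
    exact hnil y
  -- `W̄(N) ≤ W̄(N₁)`; the rank-one row prices `N₁`; monotonicity transfers the price
  have hle' : ∀ v, ∃ v₁, linMat N v = linMat N₁ v₁ := by
    intro v
    obtain ⟨c, hc⟩ := hle v
    exact ⟨c, by rw [hval, hc]⟩
  exact relCert_of_valueSpace_le N N₁ hN haff h0 h0₁ hle'
    (relCert_of_rankOne_linearPart N₁ haff hnil₁ u w fun e i j => by rw [hcoef]; rfl)

end Summit.ValiantsHypothesis.ValiantsHypothesis.Theorems.GrenetZeon.LongMassHomogenise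

end
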